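import Mathlib
import HarnessLib
import Summits.CriticalPhenomena.PercolationContinuityZ3.Theorems.PercNearOneGluingNoHeavyQuantFarGate3Reduce8
import Summits.CriticalPhenomena.PercolationContinuityZ3.Theorems.PercNearOneGluingNoHeavyQuantFarGate3BandU3

/-!
# QUANT lane R8, front "FAR beyond trees", layer one — THE DEGREE-THREE GATE AT THE OBSERVER, XXXVII: the symmetric U3 family, mirror case `r₂ ≤ r₁`

builds on p205010 (kernel theorem, internal audit signed; external expert review pending)

Support file (`--supports stmt-CriticalPhenomena-4575`), seat `prim-quant-p1` (gen 30); memo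
`run/shared/lean/prim/quant/prim-quant-p1-g30/FOR-LEAD-GATE3-RED8.md`.  Pure real algebra; standard axioms; no sorries; no definitions.

`Gate3.red8_bandU3'`: the closed-form U3 family of file XXXVI for `0 < r₂ ≤ r₁ < 1`, by the swap symmetry `Gate3.red8_symm` (file XXX) applied to
`Gate3.red8_bandU3` at `(p, r₂, r₁, nn)`; the six side conditions are those of XXXVI with `r₁ ↔ r₂`.
[cite: KozmaNitzan2024, Conjecture 3 (p. 15)]; [cite: Grimmett1999, §2.2, Thm. (2.4) p. 34]; [this work].
-/

noncomputable section

namespace Summit.CriticalPhenomena.PercolationContinuityZ3.Theorems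

namespace Quant

namespace Gate3

/-- **The symmetric U3 family, mirror case** (`r₂ ≤ r₁`). [this work] -/
theorem red8_bandU3' (p r₁ r₂ nn : ℝ) (hp0 : 0 < p) (hp1 : p < 1) (hr20 : 0 < r₂) (hr21 : r₂ ≤ r₁) (hr11 : r₁ < 1) (hn0 : 0 ≤ nn)
    (hD : 0 < ((1 - p) ^ 2 - (1 - (1 - p) * (1 - r₂)) * (1 - (1 - p) * (1 - r₁))))
    (hEa : 0 < (r₂ + r₂ * r₁ - 2 * p * r₂ + p * r₁ - p * r₂ * r₁ - p * r₂ * r₁ ^ 2 - p * r₂ ^ 2 + p * r₂ ^ 2 * r₁ + p ^ 2 * r₂ ^ 2 - p ^ 2 * r₂ ^ 2 * r₁ + p ^ 2 * r₂ * r₁ ^ 2 + p ^ 2 * r₂ * r₁ - p ^ 2 * r₁ ^ 2))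
    (hPhi : 0 ≤ (3 * (1 - p) ^ 2 * r₂ * r₁ + (1 - p ^ 2) * (r₂ + r₁) - (1 - 2 * p)))
    (hR6 : nn * p * ((1 - r₂ * r₁) - p * r₂ * (1 - r₁)) ≤ (1 - p) * (1 - p * r₁))
    (hF1 : 0 ≤ (nn * p ^ 2 * r₂ ^ 2 * r₁ - nn * p ^ 2 * r₂ ^ 2 - nn * p ^ 2 * r₂ * r₁ ^ 2 + nn * p ^ 2 * r₂ * r₁ - nn * p * r₂ ^ 2 * r₁ + nn * p * r₂ * r₁ ^ 2 + nn * p * r₂ - nn * p * r₁ - p ^ 2 * r₂ ^ 2 * r₁ + p ^ 2 * r₂ ^ 2 + p ^ 2 * r₂ * r₁ ^ 2 + p ^ 2 * r₂ * r₁ + p * r₂ ^ 2 * r₁ - p * r₂ ^ 2 - p * r₂ * r₁ ^ 2 - 2 * p * r₂ * r₁ - 2 * p * r₂ - p * r₁ ^ 2 + 2 * r₂ * r₁ + r₂ + r₁))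
    (hF2 : (nn * p ^ 3 * r₂ ^ 2 * r₁ - nn * p ^ 3 * r₂ ^ 2 - 2 * nn * p ^ 2 * r₂ ^ 2 * r₁ + nn * p ^ 2 * r₂ ^ 2 - nn * p ^ 2 * r₂ * r₁ + 2 * nn * p ^ 2 * r₂ + nn * p * r₂ ^ 2 * r₁ + nn * p * r₂ * r₁ - nn * p * r₂ - nn * p + p ^ 3 * r₂ * r₁ ^ 2 - p ^ 3 * r₂ * r₁ - p ^ 3 * r₁ ^ 2 - 2 * p ^ 2 * r₂ * r₁ ^ 2 + p ^ 2 * r₂ + p ^ 2 * r₁ ^ 2 + 3 * p ^ 2 * r₁ + p * r₂ * r₁ ^ 2 + 2 * p * r₂ * r₁ - p * r₂ - 2 * p * r₁ - 2 * p - r₂ * r₁ + 1) ≤ 0) :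
    ∀ (a0 a1 a2 b1 b2 c0 c1 d : ℝ), 0 ≤ a0 → 0 ≤ a1 → 0 ≤ a2 → 0 ≤ b1 → 0 ≤ b2 → 0 ≤ c0 → 0 ≤ c1 → 0 ≤ d →
      b1 * (b2 + (c0 + c1)) ≤ (a0 + a1 + a2) * d →
      b2 * (b1 + (c0 + c1)) ≤ (a0 + a1 + a2) * d →
      (c0 + c1) * (b1 + b2) ≤ (a0 + a1 + a2) * d →
      b1 * (a1 + a2 + c1 + d) ≤ d * (a0 + b1 + b2 + c0) →
      b2 * (a1 + a2 + c1 + d) ≤ d * (a0 + b1 + b2 + c0) →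
      c0 * (a1 + a2 + c1 + d) ≤ (c1 + d) * (a0 + b1 + b2 + c0) →
      0 < p * ((1 - r₁) * (1 - r₂)) * (a0 + c0) - (1 - p) * a2 - (1 - p) * ((1 - r₁) * (1 - r₂)) * d →
      0 < (1 - p) * (1 - r₁) * b1 - p * (r₂ * (1 - r₁)) * a0 - p * (1 - r₁) * a1 - (1 - p * r₁) * a2 - (1 - (1 - p) * (1 - r₂)) * (1 - r₁) * b2 - p * ((1 - r₁) * (1 - r₂)) * c1 →
      0 < (1 - p) * (1 - r₂) * b2 - p * (r₁ * (1 - r₂)) * a0 - p * (1 - r₂) * a1 - (1 - p * r₂) * a2 - (1 - (1 - p) * (1 - r₁)) * (1 - r₂) * b1 - p * ((1 - r₁) * (1 - r₂)) * c1 →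
      0 < (1 - p * max r₁ r₂ - nn * p * (1 - max r₁ r₂)) * a1 + (1 - p * (r₁ + r₂ * (1 - r₁)) - nn * p * ((1 - r₁) * (1 - r₂))) * c1 - nn * p * (r₁ + r₂ * (1 - r₁) - max r₁ r₂) * a0 - nn * ((1 - (1 - p) * (1 - r₁)) * (1 - r₂)) * b1 - nn * ((1 - (1 - p) * (1 - r₂)) * (1 - r₁)) * b2 →
      0 < (p * (1 + r₁ + r₂ + nn * max r₁ r₂) - 2) * a0 + (p * (1 + r₁ + r₂) + p * max r₁ r₂ * (nn - 1) - 1) * a1 + (p * (1 + r₁ + r₂) + nn - 2) * a2 + ((1 - (1 - p) * (1 - r₁)) * (1 + r₂ * (nn + 1)) - 1) * b1 + ((1 - (1 - p) * (1 - r₂)) * (1 + r₁ * (nn + 1)) - 1) * b2 + (p * (1 + (nn + 2) * (r₁ + r₂ * (1 - r₁))) - 2) * c0 + (p * (1 + (nn + 1) * (r₁ + r₂ * (1 - r₁))) - 1) * c1 + (nn + 1 - (1 - p) * ((1 - r₁) * (1 - r₂))) * d →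
      False :=
  red8_symm p r₁ r₂ nn (red8_bandU3 p r₂ r₁ nn hp0 hp1 hr20 hr21 hr11 hn0 hD hEa hPhi hR6 hF1 hF2)

end Gate3

end Quant

end Summit.CriticalPhenomena.PercolationContinuityZ3.Theorems
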